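/-
Copyright (c) 2026 the pub-hodgecm-mathlib formalisation cell (harness21).  Prover seat hodgecm-mathlib-K2E3-p34 (g3) (valved to L1), Track B «K2-LIT»,
#184♮ = hLiu418 = `stmt-HodgeConjecture-24832`; socket #41, KIND W, block (iii-fin), brick (θ) «THE FINITE CONDUCTOR LETTERS» — LEAD F0P6-plan (g15) BATCH #205 (1),
design note of F0P2-p09 (g2) (SEAT CLOSE 00:53:59Z) VERBATIM; KW desk F0P2-p08 (g3), box K2Liu-audit1 (g3).  THEOREMS ONLY (no `def`, no `instance`, no notation, no named-fact
hypothesis, no `sorry`).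
-/
import Summits.HodgeConjecture.HodgeConjecture.Theorems.K2LiuFiniteGoodPlacePackage        -- ★ p863794 (η) `exists_goodPlaceFinset_over` (the six good-place letters off `BadL`)
import Literature.NumberTheory.Automorphic.AdeleAddCharLocalComponentsUnramified         -- ★ `IsGlobalAddChar.exists_hasConductorExp_adicComponent`
import Literature.NumberTheory.Automorphic.GlobalAdditiveCharacter                       -- ★ `isGlobalAddChar_adeleAddChar`, `adeleAddCharAt_eq_adicComponent`
import Literature.NumberTheory.Automorphic.QuadraticLocalBaseChange                     -- ★ `PlacesOver.liesOver` (`1 ≤ e(w|v)`)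
import HarnessLib

/-!
# Crux `HLiu418`, socket #41, KIND W, block (iii-fin), brick (θ): THE FINITE CONDUCTOR LETTERS `Tc c hc` — ONE ∃-PACKAGE `(d, D, Tc, c)`, DATUM-LEVEL

Cell `hodgecm-mathlib`, crux item hLiu418 = `stmt-HodgeConjecture-24832` (helper lane `--supports … --as helper`, count-neutral), route of record `HCCMUnconditional`;
squad K2 ∕ K2Liu (L1), road `K2_Liu`, socket #41, KIND W (KW desk F0P2-p08 (g3)).  ★ p863485 `kindW_block_cm_of_localLetters` carries in its (iii-fin) block the CONDUCTOR
letters `(Tc : Finset 𝔭_L) (c : 𝔭_L → ℕ) (hc : ∀ w ∉ Tc, c w = 0)` (bytes :145), consumed only by the support letter `hsuppLoc` («`Ffin ≠ 0 ⟹ |S_{ab}|_w ≤ exp(lev h w + c w)`»,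
:146–150), whose payer ★ p863728 `hsuppLoc_of_level` (K2E3-p03) keeps the dual-lattice letter `hdual` BY VALUE, itself paid by ★ p863825 (ζ)
`K2LiuKindWFiniteDualLatticeLetter.hdual_of_exponent_letter` from the per-place letters `d hψ D hDg hDδ` of ★ p863721 (KW-fin-dual) and ONE numeric letter
`hdom : max(|δ|_w,1)·exp(e(w|v)·(a₀ h v + 2·D_v − d_v)) ≤ |2|_w·|δ|_w·exp(lev h w + c w)`.
THIS FILE supplies ALL the place-indexed data of that chain in ONE existential, at the level of the DATUM `(L, e, dV, dW)` (no section, no index, no `h`):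
  `∃ d D Tc c,  (∀ v, ψ_{L⁺,v} has conductor exponent d v)  ∧  (∀ v, |g₀∕g₁|_v, |g₁∕g₀|_v ≤ exp(D v))  ∧  (∀ v w′, |δ|_{w′} ≤ exp(e(w′|v)·D v))  ∧  (∀ w ∉ Tc, c w = 0)  ∧
   ∀ v w, max(|δ|_w, 1)·exp(e(w|v)·(2·D v − d v)) ≤ |2|_w·|δ|_w·exp(c w)`
(F0P2-p09 (g2)'s design note, SEAT CLOSE 00:53:59Z, VERBATIM) — so that `hdom` follows from the single remaining height reading `e(w|v)·a₀ h v ≤ lev h w` (§3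
`hdom_of_conductorLetters`, (ζ)'s `hdom` bytes TOKEN FOR TOKEN; the level letter `lev` is brick (ι)).  WITNESSES (inside the proof, no `def`): `d v` := `0` when `ψ_{L⁺,v}` has conductor
exponent `0`, else the exponent of ★ `IsGlobalAddChar.exists_hasConductorExp_adicComponent` ([WeilBNT1967, Ch. IV §2]); `D v` := the LEAST `n` with `|g₀∕g₁|_v, |g₁∕g₀|_v ≤ exp n`
and `|δ|_{w′} ≤ exp n` for all `w′ ∣ v` (`Nat.find`; `exp n ≤ exp(e·n)` as `1 ≤ e(w′|v)`, Mathlib `ramificationIdx'_ne_zero_of_liesOver` at ★ `PlacesOver.liesOver`); `c w` := the LEAST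
`n` with the fifth inequality at `v := w.under` (`|2|_w·|δ|_w ≠ 0`); `Tc := BadL` of ★ (η) `exists_goodPlaceFinset_over` — off `BadL` the six good-place letters make `d = 0`, `D = 0` and the
fifth inequality true at `n = 0`, so both minima vanish ([CasselsFrohlichANT1967, Ch. XV §3.1]: a non-zero element is a unit almost everywhere).
* §1 three `ℤᵐ⁰` lemmas: `exists_nat_le_exp`, `exists_nat_le_mul_exp`, `exp_nat_le_exp_mul`.
* §2 **`exists_conductorLetters`** (the package).  §3 **`hdom_of_conductorLetters`** ((ζ)'s `hdom` from the package + the height reading).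
HONEST LABEL.  Count-neutral helper; closes no socket by itself; `HC_CM` is proved only modulo the 7 printed citations (2 remaining named inputs:
hLiu418 = `stmt-HodgeConjecture-24832`, h413 = `stmt-HodgeConjecture-24833`) until rung 0 closes.

## References
* [WeilBNT1967] A. Weil, *Basic Number Theory* (1967): Ch. IV §2, Cor. 1 of Th. 3 (local components of a global character: a conductor everywhere, `0` almost everywhere).
* [CasselsFrohlichANT1967] Cassels–Fröhlich (eds.), *Algebraic Number Theory* (1967): Ch. XV (Tate) §2.2 (conductor of `ψ_v`), §3.1 (units almost everywhere).
* [Tate1950] J. Tate, thesis (1950): §2.2 (`{y : ψ(xy) = 1 ∀ x ∈ 𝔭^N} = 𝔭^{d−N}`).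
* [Shimura1997] G. Shimura, *Euler products and Eisenstein series*, CBMS 93 (1997): §18.4 Prop. 18.14 (dual lattice of a Fourier index).
* [NeukirchANT1999] J. Neukirch, *Algebraic Number Theory* (1999): Ch. III §2 Thm. (2.6) (ramification indices `e(w|v) ≥ 1`, `= 1` off the different).
-/

set_option autoImplicit false
-- the mandated namespace repeats the single-problem summit's segment (`HodgeConjecture.HodgeConjecture`)
set_option linter.dupNamespace false

noncomputable section

open scoped Matrix NNReal WithZero
open NumberField IsDedekindDomain Matrix
open Literature.NumberTheory.Automorphic Literature.NumberTheory.Automorphic.UnitaryGroup Literature.NumberTheory.GaloisRepresentations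
open Literature.NumberTheory.GelbartRogawski1991 Literature.NumberTheory.GelbartRogawski1991.GRConstruction
open Literature.NumberTheory.GelbartRogawski1991.UnitaryDualPair
open Literature.NumberTheory.K2Lit Literature.NumberTheory.K2Lit.SiegelDoubled
open Summit.HodgeConjecture.HodgeConjecture.Cruxes.HLiu418.K2LiuSiegelUnipotentLocalDefs
open Summit.HodgeConjecture.HodgeConjecture.Cruxes.HLiu418.K2LiuFiniteGoodPlacePackage (exists_goodPlaceFinset_over)

namespace Summit.HodgeConjecture.HodgeConjecture.Cruxes.HLiu418.K2LiuKindWFiniteConductorLetters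

/-! ## §1 Three `ℤᵐ⁰` lemmas -/

/-- every element of `ℤᵐ⁰` is bounded by `exp n` for some natural `n` (`0 ≤ exp 0`; `exp k ≤ exp k⁺`). [cite: CasselsFrohlichANT1967, Ch. XV §3.1] -/
theorem exists_nat_le_exp (a : ℤᵐ⁰) : ∃ n : ℕ, a ≤ WithZero.exp (n : ℤ) := by
  by_cases ha : a = 0
  · exact ⟨0, by rw [ha]; exact zero_le⟩
  refine ⟨(WithZero.log a).toNat, ?_⟩
  conv_lhs => rw [← WithZero.exp_log ha]
  exact WithZero.exp_le_exp.2 (Int.self_le_toNat _)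

/-- `a ≤ b·exp n` for some natural `n` as soon as `b ≠ 0`. [cite: CasselsFrohlichANT1967, Ch. XV §3.1] -/
theorem exists_nat_le_mul_exp (a : ℤᵐ⁰) {b : ℤᵐ⁰} (hb : b ≠ 0) : ∃ n : ℕ, a ≤ b * WithZero.exp (n : ℤ) := by
  obtain ⟨n, hn⟩ := exists_nat_le_exp (a * b⁻¹)
  refine ⟨n, ?_⟩
  calc a = b * (a * b⁻¹) := by rw [mul_comm a, ← mul_assoc, mul_inv_cancel₀ hb, one_mul]
    _ ≤ b * WithZero.exp (n : ℤ) := mul_le_mul' le_rfl hn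

/-- `exp n ≤ exp(e·n)` for `e ≠ 0` (a ramification index) and `n : ℕ`. [cite: NeukirchANT1999, Ch. III §2 Thm. (2.6)] -/
theorem exp_nat_le_exp_mul {e : ℕ} (he : e ≠ 0) (n : ℕ) : WithZero.exp (n : ℤ) ≤ WithZero.exp ((e : ℤ) * n) :=
  WithZero.exp_le_exp.2 (le_mul_of_one_le_left (Nat.cast_nonneg n) (by exact_mod_cast Nat.one_le_iff_ne_zero.2 he))

/-! ## §2 The package -/

section Package

variable (L : Type) [Field L] [NumberField L] [IsCMField L]
variable {N M : ℕ} (e : Fin N × Fin M ≃ Fin 2)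
  (dV : Fin N → L) (hdV : ∀ i, IsCMField.complexConj L (dV i) = dV i)
  (dW : Fin M → L) (hdW : ∀ i, IsCMField.complexConj L (dW i) = dW i)

/-- **(θ) THE FINITE CONDUCTOR LETTERS OF THE KW (iii-fin) BLOCK — ONE ∃-PACKAGE `(d, D, Tc, c)` AT THE DATUM.**  For the KW frame `(L, e : Fin N × Fin M ≃ Fin 2, dV, dW)` with non-zero
diagonal Gram entries (`hg`): there are `d : 𝔭_{L⁺} → ℤ` (conductor exponents of Tate's `ψ_{L⁺,v} = adeleAddCharAt (Fp L) v` — ★ (KW-fin-dual)'s `hψ`), `D : 𝔭_{L⁺} → ℕ` (the local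
defect: `|g₀∕g₁|_v, |g₁∕g₀|_v ≤ exp(D v)` — `hDg` —, `|δ|_{w′} ≤ exp(e(w′|v)·D v)` — `hDδ`), a finite `Tc ⊂ 𝔭_L` and `c : 𝔭_L → ℕ` vanishing off `Tc` (★ p863485's `Tc c hc` bytes), such
that at EVERY `v` and `w ∣ v`:  `max(|δ|_w, 1)·exp(e(w|v)·(2·D v − d v)) ≤ |2|_w·|δ|_w·exp(c w)`.  Off ★ (η)'s `BadL` all of `d`, `D`, `c` vanish.
[cite: WeilBNT1967, Ch. IV §2, Cor. 1 of Th. 3] [cite: CasselsFrohlichANT1967, Ch. XV §2.2, §3.1] [cite: Tate1950, §2.2] [cite: Shimura1997, §18.4 Prop. 18.14] -/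
theorem exists_conductorLetters (hg : ∀ k : Fin 2, gramR L e dV hdV dW hdW k k ≠ 0) :
    ∃ (d : HeightOneSpectrum (𝓞 (Fp L)) → ℤ) (D : HeightOneSpectrum (𝓞 (Fp L)) → ℕ)
      (Tc : Finset (HeightOneSpectrum (𝓞 L))) (c : HeightOneSpectrum (𝓞 L) → ℕ),
      (∀ v, (adeleAddCharAt (Fp L) v).HasConductorExp (d v)) ∧
      (∀ v : HeightOneSpectrum (𝓞 (Fp L)),
        Valued.v (algebraMap (Fp L) (v.adicCompletion (Fp L)) (gramR L e dV hdV dW hdW 0 0) *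
            (algebraMap (Fp L) (v.adicCompletion (Fp L)) (gramR L e dV hdV dW hdW 1 1))⁻¹) ≤ WithZero.exp (D v : ℤ) ∧
          Valued.v (algebraMap (Fp L) (v.adicCompletion (Fp L)) (gramR L e dV hdV dW hdW 1 1) *
            (algebraMap (Fp L) (v.adicCompletion (Fp L)) (gramR L e dV hdV dW hdW 0 0))⁻¹) ≤ WithZero.exp (D v : ℤ)) ∧
      (∀ (v : HeightOneSpectrum (𝓞 (Fp L))) (w' : UnitaryGroup.PlacesOver L v),
        Valued.v ((imagUnit L : L) : w'.1.adicCompletion L) ≤ WithZero.exp ((v.asIdeal.ramificationIdx' w'.1.asIdeal : ℤ) * D v)) ∧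
      (∀ w, w ∉ Tc → c w = 0) ∧
      ∀ (v : HeightOneSpectrum (𝓞 (Fp L))) (w : UnitaryGroup.PlacesOver L v),
        max (Valued.v ((imagUnit L : L) : w.1.adicCompletion L)) 1 *
            WithZero.exp ((v.asIdeal.ramificationIdx' w.1.asIdeal : ℤ) * (2 * (D v : ℤ) - d v)) ≤
          Valued.v ((2 : L) : w.1.adicCompletion L) * Valued.v ((imagUnit L : L) : w.1.adicCompletion L) * WithZero.exp ((c w.1 : ℕ) : ℤ) := by
  classical
  obtain ⟨BadL, hBadL⟩ := exists_goodPlaceFinset_over L e dV hdV dW hdW hg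
  -- `d`: a conductor exponent of `ψ_{L⁺,v}` at every `v`, chosen `= 0` wherever `0` is one
  have hexd : ∀ v : HeightOneSpectrum (𝓞 (Fp L)), ∃ m : ℤ, (adeleAddCharAt (Fp L) v).HasConductorExp m := fun v => by
    rw [adeleAddCharAt_eq_adicComponent]
    exact (isGlobalAddChar_adeleAddChar (Fp L)).exists_hasConductorExp_adicComponent v
  set d : HeightOneSpectrum (𝓞 (Fp L)) → ℤ := fun v => if (adeleAddCharAt (Fp L) v).HasConductorExp 0 then 0 else Classical.choose (hexd v) with hddef
  have hd : ∀ v, (adeleAddCharAt (Fp L) v).HasConductorExp (d v) := fun v => by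
    by_cases h : (adeleAddCharAt (Fp L) v).HasConductorExp 0
    · simp only [hddef, if_pos h]; exact h
    · simp only [hddef, if_neg h]; exact Classical.choose_spec (hexd v)
  have hd0 : ∀ v, (adeleAddCharAt (Fp L) v).HasConductorExp 0 → d v = 0 := fun v h => by simp only [hddef, if_pos h]
  -- `D`: the least common exponent bound of the two Gram ratios and of `|δ|_{w′}`, `w′ ∣ v`
  have hexD : ∀ v : HeightOneSpectrum (𝓞 (Fp L)), ∃ n : ℕ,
      Valued.v (algebraMap (Fp L) (v.adicCompletion (Fp L)) (gramR L e dV hdV dW hdW 0 0) *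
          (algebraMap (Fp L) (v.adicCompletion (Fp L)) (gramR L e dV hdV dW hdW 1 1))⁻¹) ≤ WithZero.exp (n : ℤ) ∧
        Valued.v (algebraMap (Fp L) (v.adicCompletion (Fp L)) (gramR L e dV hdV dW hdW 1 1) *
          (algebraMap (Fp L) (v.adicCompletion (Fp L)) (gramR L e dV hdV dW hdW 0 0))⁻¹) ≤ WithZero.exp (n : ℤ) ∧
        ∀ w' : UnitaryGroup.PlacesOver L v, Valued.v ((imagUnit L : L) : w'.1.adicCompletion L) ≤ WithZero.exp (n : ℤ) := by
    intro v
    obtain ⟨n₁, h₁⟩ := exists_nat_le_exp (Valued.v (algebraMap (Fp L) (v.adicCompletion (Fp L)) (gramR L e dV hdV dW hdW 0 0) *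
      (algebraMap (Fp L) (v.adicCompletion (Fp L)) (gramR L e dV hdV dW hdW 1 1))⁻¹))
    obtain ⟨n₂, h₂⟩ := exists_nat_le_exp (Valued.v (algebraMap (Fp L) (v.adicCompletion (Fp L)) (gramR L e dV hdV dW hdW 1 1) *
      (algebraMap (Fp L) (v.adicCompletion (Fp L)) (gramR L e dV hdV dW hdW 0 0))⁻¹))
    choose n₃ h₃ using fun w' : UnitaryGroup.PlacesOver L v => exists_nat_le_exp (Valued.v ((imagUnit L : L) : w'.1.adicCompletion L))
    refine ⟨n₁ + n₂ + Finset.univ.sup n₃, h₁.trans (WithZero.exp_le_exp.2 ?_), h₂.trans (WithZero.exp_le_exp.2 ?_), fun w' => (h₃ w').trans (WithZero.exp_le_exp.2 ?_)⟩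
    · exact_mod_cast (by omega : n₁ ≤ n₁ + n₂ + Finset.univ.sup n₃)
    · exact_mod_cast (by omega : n₂ ≤ n₁ + n₂ + Finset.univ.sup n₃)
    · have hle : n₃ w' ≤ Finset.univ.sup n₃ := Finset.le_sup (Finset.mem_univ w')
      exact_mod_cast (by omega : n₃ w' ≤ n₁ + n₂ + Finset.univ.sup n₃)
  set D : HeightOneSpectrum (𝓞 (Fp L)) → ℕ := fun v => Nat.find (hexD v) with hDdef
  have hD : ∀ v, Valued.v (algebraMap (Fp L) (v.adicCompletion (Fp L)) (gramR L e dV hdV dW hdW 0 0) *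
            (algebraMap (Fp L) (v.adicCompletion (Fp L)) (gramR L e dV hdV dW hdW 1 1))⁻¹) ≤ WithZero.exp (D v : ℤ) ∧
          Valued.v (algebraMap (Fp L) (v.adicCompletion (Fp L)) (gramR L e dV hdV dW hdW 1 1) *
            (algebraMap (Fp L) (v.adicCompletion (Fp L)) (gramR L e dV hdV dW hdW 0 0))⁻¹) ≤ WithZero.exp (D v : ℤ) ∧
          ∀ w' : UnitaryGroup.PlacesOver L v, Valued.v ((imagUnit L : L) : w'.1.adicCompletion L) ≤ WithZero.exp (D v : ℤ) := fun v => by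
    rw [hDdef]; exact Nat.find_spec (hexD v)
  have hD0 : ∀ v, (Valued.v (algebraMap (Fp L) (v.adicCompletion (Fp L)) (gramR L e dV hdV dW hdW 0 0) *
            (algebraMap (Fp L) (v.adicCompletion (Fp L)) (gramR L e dV hdV dW hdW 1 1))⁻¹) ≤ WithZero.exp ((0 : ℕ) : ℤ) ∧
          Valued.v (algebraMap (Fp L) (v.adicCompletion (Fp L)) (gramR L e dV hdV dW hdW 1 1) *
            (algebraMap (Fp L) (v.adicCompletion (Fp L)) (gramR L e dV hdV dW hdW 0 0))⁻¹) ≤ WithZero.exp ((0 : ℕ) : ℤ) ∧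
          ∀ w' : UnitaryGroup.PlacesOver L v, Valued.v ((imagUnit L : L) : w'.1.adicCompletion L) ≤ WithZero.exp ((0 : ℕ) : ℤ)) → D v = 0 := fun v h => by
    rw [hDdef]; exact (Nat.find_eq_zero (hexD v)).2 h
  -- `1 ≤ e(w|v)`
  have he : ∀ (v : HeightOneSpectrum (𝓞 (Fp L))) (w : UnitaryGroup.PlacesOver L v), v.asIdeal.ramificationIdx' w.1.asIdeal ≠ 0 := fun v w => by
    haveI := PlacesOver.liesOver (E := L) w
    exact Ideal.IsDedekindDomain.ramificationIdx'_ne_zero_of_liesOver w.1.asIdeal v.ne_bot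
  -- `c`: the least exponent in the fifth inequality, place by place of `L` (`v := w.under`)
  have hexc : ∀ w₀ : HeightOneSpectrum (𝓞 L), ∃ n : ℕ,
      max (Valued.v ((imagUnit L : L) : w₀.adicCompletion L)) 1 *
          WithZero.exp (((w₀.under (𝓞 (Fp L))).asIdeal.ramificationIdx' w₀.asIdeal : ℤ) *
            (2 * (D (w₀.under (𝓞 (Fp L))) : ℤ) - d (w₀.under (𝓞 (Fp L))))) ≤
        Valued.v ((2 : L) : w₀.adicCompletion L) * Valued.v ((imagUnit L : L) : w₀.adicCompletion L) * WithZero.exp (n : ℤ) := fun w₀ =>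
    exists_nat_le_mul_exp _ (mul_ne_zero
      ((Valuation.ne_zero_iff _).2 ((map_ne_zero (algebraMap L (w₀.adicCompletion L))).2 (two_ne_zero : (2 : L) ≠ 0)))
      ((Valuation.ne_zero_iff _).2 ((map_ne_zero (algebraMap L (w₀.adicCompletion L))).2 (imagUnit_ne_zero L))))
  set c : HeightOneSpectrum (𝓞 L) → ℕ := fun w₀ => Nat.find (hexc w₀) with hcdef
  have hc : ∀ w₀ : HeightOneSpectrum (𝓞 L),
        max (Valued.v ((imagUnit L : L) : w₀.adicCompletion L)) 1 *
            WithZero.exp (((w₀.under (𝓞 (Fp L))).asIdeal.ramificationIdx' w₀.asIdeal : ℤ) *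
              (2 * (D (w₀.under (𝓞 (Fp L))) : ℤ) - d (w₀.under (𝓞 (Fp L))))) ≤
          Valued.v ((2 : L) : w₀.adicCompletion L) * Valued.v ((imagUnit L : L) : w₀.adicCompletion L) * WithZero.exp ((c w₀ : ℕ) : ℤ) := fun w₀ => by
    rw [hcdef]; exact Nat.find_spec (hexc w₀)
  have hc0 : ∀ w₀ : HeightOneSpectrum (𝓞 L),
        max (Valued.v ((imagUnit L : L) : w₀.adicCompletion L)) 1 *
            WithZero.exp (((w₀.under (𝓞 (Fp L))).asIdeal.ramificationIdx' w₀.asIdeal : ℤ) *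
              (2 * (D (w₀.under (𝓞 (Fp L))) : ℤ) - d (w₀.under (𝓞 (Fp L))))) ≤
          Valued.v ((2 : L) : w₀.adicCompletion L) * Valued.v ((imagUnit L : L) : w₀.adicCompletion L) * WithZero.exp (((0 : ℕ) : ℕ) : ℤ) → c w₀ = 0 :=
    fun w₀ h => by rw [hcdef]; exact (Nat.find_eq_zero (hexc w₀)).2 h
  refine ⟨d, D, BadL, c, hd, fun v => ⟨(hD v).1, (hD v).2.1⟩, fun v w' => ((hD v).2.2 w').trans (exp_nat_le_exp_mul (he v w') (D v)),
    fun w₀ hw₀ => ?_, fun v w => ?_⟩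
  · -- off `BadL`: the six good-place letters at `v₀ := w₀.under`, read at the place `⟨w₀, rfl⟩` over it
    obtain ⟨hψ0, -, -, h2, -, hδ, hgv⟩ := hBadL (w₀.under (𝓞 (Fp L))) ⟨w₀, rfl⟩ hw₀
    have hdv : d (w₀.under (𝓞 (Fp L))) = 0 := hd0 _ hψ0
    have hDv : D (w₀.under (𝓞 (Fp L))) = 0 := by
      refine hD0 _ ⟨?_, ?_, fun w' => ?_⟩
      · rw [Valuation.map_mul, map_inv₀, hgv 0, hgv 1, inv_one, mul_one, Nat.cast_zero, WithZero.exp_zero]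
      · rw [Valuation.map_mul, map_inv₀, hgv 0, hgv 1, inv_one, mul_one, Nat.cast_zero, WithZero.exp_zero]
      · rw [hδ w', Nat.cast_zero, WithZero.exp_zero]
    refine hc0 w₀ ?_
    have h2w : Valued.v ((2 : L) : w₀.adicCompletion L) = 1 := h2 ⟨w₀, rfl⟩
    have hδw : Valued.v ((imagUnit L : L) : w₀.adicCompletion L) = 1 := hδ ⟨w₀, rfl⟩
    rw [hdv, hDv, h2w, hδw, max_self, one_mul, one_mul, one_mul]
    simp only [Nat.cast_zero, mul_zero, sub_zero, WithZero.exp_zero, le_refl]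
  · -- the fifth inequality: `v = w.1.under`, and `c w.1` is the least exponent there
    obtain ⟨w₁, hw₁⟩ := w
    subst hw₁
    exact hc w₁

end Package

/-! ## §3 (ζ)'s numeric letter `hdom` from the package and the height reading -/

section Dom

variable (L : Type) [Field L] [NumberField L] [IsCMField L]

/-- **`hdom` OF ★ (ζ) `hdual_of_exponent_letter`, TOKEN FOR TOKEN, from the fifth conjunct of `exists_conductorLetters` and ONE height reading `e(w|v)·a₀ h v ≤ lev h w`:**
`max(|δ|_w, 1)·exp(e(w|v)·(a₀ h v + 2·D v − d v)) ≤ |2|_w·|δ|_w·exp(lev h w + c w)` (split `exp`, bound the two factors, recombine).  The index type `X` of `h` is free (the consumer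
takes `X := HA`). [cite: Shimura1997, §18.4 Prop. 18.14] [cite: Tate1950, §2.2] -/
theorem hdom_of_conductorLetters {X : Type*} {d : HeightOneSpectrum (𝓞 (Fp L)) → ℤ} {D : HeightOneSpectrum (𝓞 (Fp L)) → ℕ} {c : HeightOneSpectrum (𝓞 L) → ℕ}
    (h5 : ∀ (v : HeightOneSpectrum (𝓞 (Fp L))) (w : UnitaryGroup.PlacesOver L v),
      max (Valued.v ((imagUnit L : L) : w.1.adicCompletion L)) 1 *
          WithZero.exp ((v.asIdeal.ramificationIdx' w.1.asIdeal : ℤ) * (2 * (D v : ℤ) - d v)) ≤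
        Valued.v ((2 : L) : w.1.adicCompletion L) * Valued.v ((imagUnit L : L) : w.1.adicCompletion L) * WithZero.exp ((c w.1 : ℕ) : ℤ))
    (lev : X → HeightOneSpectrum (𝓞 L) → ℕ) (a₀ : X → HeightOneSpectrum (𝓞 (Fp L)) → ℤ)
    (hlev : ∀ (h : X) (v : HeightOneSpectrum (𝓞 (Fp L))) (w : UnitaryGroup.PlacesOver L v), (v.asIdeal.ramificationIdx' w.1.asIdeal : ℤ) * a₀ h v ≤ (lev h w.1 : ℤ)) :
    ∀ (h : X) (v : HeightOneSpectrum (𝓞 (Fp L))) (w : UnitaryGroup.PlacesOver L v),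
      max (Valued.v ((imagUnit L : L) : w.1.adicCompletion L)) 1 *
          WithZero.exp ((v.asIdeal.ramificationIdx' w.1.asIdeal : ℤ) * (a₀ h v + 2 * (D v : ℤ) - d v)) ≤
        Valued.v ((2 : L) : w.1.adicCompletion L) * Valued.v ((imagUnit L : L) : w.1.adicCompletion L) * WithZero.exp (((lev h w.1 + c w.1 : ℕ) : ℤ)) := by
  intro h v w
  have hsplit : (v.asIdeal.ramificationIdx' w.1.asIdeal : ℤ) * (a₀ h v + 2 * (D v : ℤ) - d v) =
      (v.asIdeal.ramificationIdx' w.1.asIdeal : ℤ) * a₀ h v + (v.asIdeal.ramificationIdx' w.1.asIdeal : ℤ) * (2 * (D v : ℤ) - d v) := by ring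
  calc max (Valued.v ((imagUnit L : L) : w.1.adicCompletion L)) 1 *
          WithZero.exp ((v.asIdeal.ramificationIdx' w.1.asIdeal : ℤ) * (a₀ h v + 2 * (D v : ℤ) - d v))
        = WithZero.exp ((v.asIdeal.ramificationIdx' w.1.asIdeal : ℤ) * a₀ h v) *
            (max (Valued.v ((imagUnit L : L) : w.1.adicCompletion L)) 1 *
              WithZero.exp ((v.asIdeal.ramificationIdx' w.1.asIdeal : ℤ) * (2 * (D v : ℤ) - d v))) := by
          rw [hsplit, WithZero.exp_add, mul_left_comm]
    _ ≤ WithZero.exp ((lev h w.1 : ℕ) : ℤ) *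
            (Valued.v ((2 : L) : w.1.adicCompletion L) * Valued.v ((imagUnit L : L) : w.1.adicCompletion L) * WithZero.exp ((c w.1 : ℕ) : ℤ)) :=
          mul_le_mul' (WithZero.exp_le_exp.2 (hlev h v w)) (h5 v w)
    _ = Valued.v ((2 : L) : w.1.adicCompletion L) * Valued.v ((imagUnit L : L) : w.1.adicCompletion L) * WithZero.exp (((lev h w.1 + c w.1 : ℕ) : ℤ)) := by
          rw [Nat.cast_add, WithZero.exp_add]
          simp only [mul_assoc, mul_comm, mul_left_comm]

end Dom

end Summit.HodgeConjecture.HodgeConjecture.Cruxes.HLiu418.K2LiuKindWFiniteConductorLetters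

end
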